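import Literature.NumberTheory.LFunctions.GRHTwistedCharacterPrimeSumsZeros
import Literature.NumberTheory.LFunctions.GRHTwistedCharacterPrimeSumsIdentity
import HarnessLib

/-!
# Twisted prime sums under GRH, IV: averaging the endpoints

Topic `Literature/NumberTheory/LFunctions`. THEOREMS (everything proved). Fourth support file of
the GRH bound for the twisted Chebyshev function `ψ(x, χ, t) = ∑_{n ≤ x} χ(n) Λ(n) n^{-it}`
(`GRHTwistedCharacterPrimeSums.lean`): the tools that turn the pointwise inequality of
`GRHTwistedCharacterPrimeSumsIdentity.lean`,
`‖S₃(X) + Z(X) − Z(c)‖ ≤ B` with `Z(y) = ∑_ρ m(ρ) y^{ρ-it}/(ρ − it)`, into a bound for `S₃(x)`: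

* `norm_add_avg_le` — averaging a pointwise bound `‖S + g(y)‖ ≤ B` over `y ∈ [a, b]`;
* `norm_avg_zeroSum_le` — under RH, the average of `Z` over `[a, b]` is
  `≤ ∑_ρ m(ρ) min(b^{1/2}/|w|, 2b^{3/2}/((b − a)|w|²))`, `w = ρ − it`
  (`GRHTwistedPrimeSum.norm_avg_cpow_div_le_min`), whence
  `norm_avg_zeroSum_Icc_le` (`[x, x + √x]`: `≤ 4√2 √x ∑ m(ρ) min(1/|w|, √x/|w|²)`) and
  `norm_avg_zeroSum_c_le` (`[9/4, 11/4]`: `≤ 31 ∑ m(ρ) min(1/|w|, 1/|w|²)`), the damped sums of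
  `GRHTwistedPrimeSum.exists_sum_mul_min_le`;
* `norm_sum_Ioc_twist_le` — the trivial short-interval bound
  `‖∑_{a < n ≤ b} χ(n)Λ(n)n^{-it}‖ ≤ (b − a) log b`.

## References

* H. L. Montgomery, R. C. Vaughan, *Multiplicative Number Theory I. Classical Theory*, CUP 2007,
  §13.1 (proof of Theorem 13.7) and Lemma 12.8. [MontgomeryVaughan2007]
-/

noncomputable section

open Complex Filter Topology Set MeasureTheory intervalIntegral
open scoped Real ArithmeticFunction.vonMangoldt

namespace Literature.NumberTheory.LFunctions

namespace GRHTwistedPrimeSum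

open DirichletCharacter ExplicitPsiChar

/-! ### Averaging a pointwise bound -/

/-- If `‖S + g(y)‖ ≤ B` for all `y ∈ [a, b]` (`a < b`, `g` continuous), then
`‖S + (b − a)⁻¹ ∫_a^b g‖ ≤ B`. [folklore] -/
theorem norm_add_avg_le {S : ℂ} {g : ℝ → ℂ} {a b B : ℝ} (hab : a < b)
    (hg : ContinuousOn g (Icc a b)) (h : ∀ y ∈ Icc a b, ‖S + g y‖ ≤ B) :
    ‖S + ((b - a)⁻¹ : ℝ) * ∫ y in a..b, g y‖ ≤ B := by
  have hba : 0 < b - a := sub_pos.2 hab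
  have hgi : IntervalIntegrable g volume a b := hg.intervalIntegrable_of_Icc hab.le
  have hba' : (b : ℂ) - a ≠ 0 := by rw [← Complex.ofReal_sub]; exact Complex.ofReal_ne_zero.2 hba.ne'
  have heq : S + ((b - a)⁻¹ : ℝ) * ∫ y in a..b, g y =
      ((b - a)⁻¹ : ℝ) * ∫ y in a..b, (S + g y) := by
    rw [intervalIntegral.integral_add intervalIntegrable_const hgi, intervalIntegral.integral_const,
      mul_add, Complex.real_smul]
    congr 1
    push_cast
    field_simp
  rw [heq, norm_mul, Complex.norm_real, Real.norm_of_nonneg (inv_nonneg.2 hba.le)]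
  have hI : ‖∫ y in a..b, (S + g y)‖ ≤ B * |b - a| :=
    intervalIntegral.norm_integral_le_of_norm_le_const fun y hy ↦
      h y (by rw [uIoc_of_le hab.le] at hy; exact ⟨hy.1.le, hy.2⟩)
  rw [abs_of_pos hba] at hI
  calc (b - a)⁻¹ * ‖∫ y in a..b, (S + g y)‖ ≤ (b - a)⁻¹ * (B * (b - a)) :=
        mul_le_mul_of_nonneg_left hI (inv_nonneg.2 hba.le)
    _ = B := by field_simp

/-! ### Averages of the twisted zero sum -/

/-- The twisted zero sum `y ↦ ∑_ρ m(ρ) y^{ρ-it}/(ρ − it)` is continuous on `[a, b]`, `a > 0`.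
[folklore] -/
theorem continuousOn_zeroSum (P : Finset ℂ) (m : ℂ → ℂ) (t : ℝ) {a b : ℝ} (ha : 0 < a) :
    ContinuousOn (fun y : ℝ ↦ ∑ ρ ∈ P, m ρ * ((y : ℂ) ^ (ρ - t * I) / (ρ - t * I))) (Icc a b) :=
  continuousOn_finsetSum P fun _ _ ↦
    continuousOn_const.mul ((continuousOn_ofReal_cpow _ ha).div_const _)

/-- Comparison of the two `min`-weights: if `A₁ ≤ C` and `A₂/d ≤ C/h` then
`min(A₁/r, A₂/(d r²)) ≤ C min(1/r, 1/(h r²))`. [folklore] -/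
theorem min_div_le_mul_min {A₁ A₂ C d h r : ℝ} (hr : 0 < r) (hC : 0 ≤ C)
    (h1 : A₁ ≤ C) (h2 : A₂ / d ≤ C / h) :
    min (A₁ / r) (A₂ / (d * r ^ 2)) ≤ C * min (1 / r) (1 / (h * r ^ 2)) := by
  rw [mul_min_of_nonneg _ _ hC]
  refine min_le_min ?_ ?_
  · rw [mul_one_div]; exact div_le_div_of_nonneg_right h1 hr.le
  · rw [mul_one_div, show A₂ / (d * r ^ 2) = A₂ / d / r ^ 2 by rw [div_div],
      show C / (h * r ^ 2) = C / h / r ^ 2 by rw [div_div]]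
    exact div_le_div_of_nonneg_right h2 (by positivity)

/-- **The averaged twisted zero sum, under RH.** For a finite set `P` of points on the critical
line, `0 < a < b` and real `t`,
`‖(b − a)⁻¹ ∫_a^b ∑_ρ m(ρ) y^{ρ-it}/(ρ−it) dy‖ ≤ ∑_ρ m(ρ) min(b^{1/2}/|w|, 2b^{3/2}/((b−a)|w|²))`,
`w = ρ − it`, `m ≥ 0`. [folklore] -/
theorem norm_avg_zeroSum_le (P : Finset ℂ) {m : ℂ → ℝ} (hm : ∀ ρ ∈ P, 0 ≤ m ρ)
    (hP : ∀ ρ ∈ P, ρ.re = 1 / 2) (t : ℝ) {a b : ℝ} (ha : 0 < a) (hab : a < b) :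
    ‖((b - a)⁻¹ : ℝ) * ∫ y in a..b, ∑ ρ ∈ P, (m ρ : ℂ) * ((y : ℂ) ^ (ρ - t * I) / (ρ - t * I))‖ ≤
      ∑ ρ ∈ P, m ρ * min (b ^ (1 / 2 : ℝ) / ‖ρ - t * I‖)
        (2 * b ^ (3 / 2 : ℝ) / ((b - a) * ‖ρ - t * I‖ ^ 2)) := by
  have hint : ∀ ρ ∈ P, IntervalIntegrable
      (fun y : ℝ ↦ (m ρ : ℂ) * ((y : ℂ) ^ (ρ - t * I) / (ρ - t * I))) volume a b := fun ρ _ ↦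
    (continuousOn_const.mul ((continuousOn_ofReal_cpow _ ha).div_const _)).intervalIntegrable_of_Icc
      hab.le
  rw [intervalIntegral.integral_finsetSum hint, Finset.mul_sum]
  refine (norm_sum_le _ _).trans (Finset.sum_le_sum fun ρ hρ ↦ ?_)
  have hw : (ρ - t * I).re = 1 / 2 := by simp [hP ρ hρ]
  rw [intervalIntegral.integral_const_mul, mul_left_comm, norm_mul, Complex.norm_real,
    Real.norm_of_nonneg (hm ρ hρ)]
  exact mul_le_mul_of_nonneg_left (norm_avg_cpow_div_le_min ha hab hw) (hm ρ hρ)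

/-- `(2x)^{3/2} = 2√2 · x · x^{1/2}` bookkeeping: for `x ≥ 1` with `s = x^{1/2}`,
`(x + s)^{1/2} ≤ 4√2 s` and `2 (x + s)^{3/2}/s ≤ 4√2 s · s`. [folklore] -/
theorem rpow_bounds_Icc {x : ℝ} (hx : 1 ≤ x) :
    (x + Real.sqrt x) ^ (1 / 2 : ℝ) ≤ 4 * Real.sqrt 2 * Real.sqrt x ∧
      2 * (x + Real.sqrt x) ^ (3 / 2 : ℝ) / Real.sqrt x ≤ 4 * Real.sqrt 2 * Real.sqrt x / (Real.sqrt x)⁻¹ := by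
  have hx0 : 0 < x := by linarith
  set s := Real.sqrt x with hs
  have hs1 : 1 ≤ s := by rw [hs]; exact Real.one_le_sqrt.2 hx
  have hs0 : 0 < s := by linarith
  have hss : s * s = x := Real.mul_self_sqrt hx0.le
  have hsx : s ≤ x := by nlinarith
  have h2x : x + s ≤ 2 * x := by linarith
  have h2x0 : 0 ≤ x + s := by positivity
  have hsqrt2x : Real.sqrt (2 * x) = Real.sqrt 2 * s := by rw [Real.sqrt_mul (by norm_num), hs]
  have hsq2 : 1 ≤ Real.sqrt 2 := Real.one_le_sqrt.2 (by norm_num)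
  have h1 : (x + s) ^ (1 / 2 : ℝ) ≤ Real.sqrt 2 * s := by
    rw [← Real.sqrt_eq_rpow, ← hsqrt2x]
    exact Real.sqrt_le_sqrt h2x
  constructor
  · calc (x + s) ^ (1 / 2 : ℝ) ≤ Real.sqrt 2 * s := h1
      _ ≤ 4 * Real.sqrt 2 * s := by nlinarith
  · have h32 : (x + s) ^ (3 / 2 : ℝ) ≤ (2 * x) ^ (3 / 2 : ℝ) :=
      Real.rpow_le_rpow h2x0 h2x (by norm_num)
    have h2x32 : (2 * x) ^ (3 / 2 : ℝ) = 2 * x * (Real.sqrt 2 * s) := by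
      rw [show (3 / 2 : ℝ) = 1 + 1 / 2 by norm_num, Real.rpow_add (by positivity), Real.rpow_one,
        ← Real.sqrt_eq_rpow, hsqrt2x]
    rw [div_inv_eq_mul, div_le_iff₀ hs0]
    calc 2 * (x + s) ^ (3 / 2 : ℝ) ≤ 2 * (2 * x * (Real.sqrt 2 * s)) := by rw [← h2x32]; linarith
      _ = 4 * Real.sqrt 2 * s * s * s := by rw [← hss]; ring

/-- **Average over `[x, x + √x]`.** Under RH (`Re ρ = 1/2` on `P`), for `x ≥ 1`, `s = √x`:
`‖s⁻¹ ∫_x^{x+s} Z(y) dy‖ ≤ 4√2 s ∑_ρ m(ρ) min(1/|w|, 1/(s⁻¹|w|²))`. [folklore] -/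
theorem norm_avg_zeroSum_Icc_le (P : Finset ℂ) {m : ℂ → ℝ} (hm : ∀ ρ ∈ P, 0 ≤ m ρ)
    (hP : ∀ ρ ∈ P, ρ.re = 1 / 2) (t : ℝ) {x : ℝ} (hx : 1 ≤ x) :
    ‖((Real.sqrt x)⁻¹ : ℝ) * ∫ y in x..x + Real.sqrt x,
        ∑ ρ ∈ P, (m ρ : ℂ) * ((y : ℂ) ^ (ρ - t * I) / (ρ - t * I))‖ ≤
      4 * Real.sqrt 2 * Real.sqrt x * ∑ ρ ∈ P, m ρ *
        min (1 / ‖ρ - t * I‖) (1 / ((Real.sqrt x)⁻¹ * ‖ρ - t * I‖ ^ 2)) := by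
  have hx0 : 0 < x := by linarith
  set s := Real.sqrt x with hs
  have hs0 : 0 < s := Real.sqrt_pos.2 hx0
  have hab : x < x + s := by linarith
  obtain ⟨hb1, hb2⟩ := rpow_bounds_Icc hx
  have h := norm_avg_zeroSum_le P hm hP t hx0 hab
  rw [add_sub_cancel_left] at h
  refine h.trans ?_
  rw [Finset.mul_sum]
  refine Finset.sum_le_sum fun ρ hρ ↦ ?_
  rw [mul_left_comm]
  refine mul_le_mul_of_nonneg_left ?_ (hm ρ hρ)
  have hw0 : 0 < ‖ρ - t * I‖ := lt_of_lt_of_le (by norm_num) (half_le_norm_sub t (hP ρ hρ))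
  exact min_div_le_mul_min hw0 (by positivity) hb1 hb2

/-- **Average over `[9/4, 11/4]`.** Under RH:
`‖2 ∫_{9/4}^{11/4} Z(c) dc‖ ≤ 31 ∑_ρ m(ρ) min(1/|w|, 1/(1 · |w|²))`. [folklore] -/
theorem norm_avg_zeroSum_c_le (P : Finset ℂ) {m : ℂ → ℝ} (hm : ∀ ρ ∈ P, 0 ≤ m ρ)
    (hP : ∀ ρ ∈ P, ρ.re = 1 / 2) (t : ℝ) :
    ‖(((11 / 4 : ℝ) - 9 / 4)⁻¹ : ℝ) * ∫ y in (9 / 4 : ℝ)..(11 / 4),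
        ∑ ρ ∈ P, (m ρ : ℂ) * ((y : ℂ) ^ (ρ - t * I) / (ρ - t * I))‖ ≤
      31 * ∑ ρ ∈ P, m ρ * min (1 / ‖ρ - t * I‖) (1 / (1 * ‖ρ - t * I‖ ^ 2)) := by
  have h := norm_avg_zeroSum_le P hm hP t (a := 9 / 4) (b := 11 / 4) (by norm_num) (by norm_num)
  refine h.trans ?_
  rw [Finset.mul_sum]
  refine Finset.sum_le_sum fun ρ hρ ↦ ?_
  rw [mul_left_comm]
  refine mul_le_mul_of_nonneg_left ?_ (hm ρ hρ)
  have hw0 : 0 < ‖ρ - t * I‖ := lt_of_lt_of_le (by norm_num) (half_le_norm_sub t (hP ρ hρ))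
  have hb0 : (1 : ℝ) ≤ 11 / 4 := by norm_num
  have hb1 : (11 / 4 : ℝ) ^ (1 / 2 : ℝ) ≤ 31 :=
    calc (11 / 4 : ℝ) ^ (1 / 2 : ℝ) ≤ (11 / 4 : ℝ) ^ (1 : ℝ) :=
          Real.rpow_le_rpow_of_exponent_le hb0 (by norm_num)
      _ ≤ 31 := by norm_num
  have hb2 : 2 * (11 / 4 : ℝ) ^ (3 / 2 : ℝ) / (11 / 4 - 9 / 4) ≤ 31 / 1 := by
    have h32 : (11 / 4 : ℝ) ^ (3 / 2 : ℝ) ≤ (11 / 4 : ℝ) ^ (2 : ℝ) :=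
      Real.rpow_le_rpow_of_exponent_le hb0 (by norm_num)
    have h2 : (11 / 4 : ℝ) ^ (2 : ℝ) = 121 / 16 := by rw [Real.rpow_two]; norm_num
    rw [h2] at h32
    have e : 2 * (11 / 4 : ℝ) ^ (3 / 2 : ℝ) / (11 / 4 - 9 / 4) = 4 * (11 / 4 : ℝ) ^ (3 / 2 : ℝ) := by ring
    rw [e]; linarith
  exact min_div_le_mul_min hw0 (by norm_num) hb1 hb2

/-! ### The trivial short-interval bound -/

/-- `‖χ(n) Λ(n) n^{-it}‖ ≤ Λ(n)`. [folklore] -/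
theorem norm_twistTerm_le {q : ℕ} (χ : DirichletCharacter ℂ q) (t : ℝ) (n : ℕ) :
    ‖χ n * Λ n * (n : ℂ) ^ (-(t * I))‖ ≤ Λ n := by
  rcases Nat.eq_zero_or_pos n with rfl | hn
  · simp
  · rw [norm_mul, norm_mul, Complex.norm_real, Real.norm_of_nonneg ArithmeticFunction.vonMangoldt_nonneg,
      Complex.norm_natCast_cpow_of_pos hn]
    simp only [neg_re, mul_re, ofReal_re, I_re, mul_zero, ofReal_im, I_im, mul_one, sub_self,
      neg_zero, Real.rpow_zero, mul_one]
    exact mul_le_of_le_one_left ArithmeticFunction.vonMangoldt_nonneg (χ.norm_le_one _)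

/-- **Short intervals, trivially.** `‖∑_{a < n ≤ b} χ(n)Λ(n) n^{-it}‖ ≤ (b − a) log b`
(each term is `≤ Λ(n) ≤ log n ≤ log b`). [folklore] -/
theorem norm_sum_Ioc_twist_le {q : ℕ} (χ : DirichletCharacter ℂ q) (t : ℝ) {a b : ℕ} (hab : a ≤ b) :
    ‖∑ n ∈ Finset.Ioc a b, χ n * Λ n * (n : ℂ) ^ (-(t * I))‖ ≤ ((b : ℝ) - a) * Real.log b := by
  calc ‖∑ n ∈ Finset.Ioc a b, χ n * Λ n * (n : ℂ) ^ (-(t * I))‖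
      ≤ ∑ n ∈ Finset.Ioc a b, ‖χ n * Λ n * (n : ℂ) ^ (-(t * I))‖ := norm_sum_le _ _
    _ ≤ ∑ n ∈ Finset.Ioc a b, Real.log b := by
        refine Finset.sum_le_sum fun n hn ↦ (norm_twistTerm_le χ t n).trans ?_
        rw [Finset.mem_Ioc] at hn
        refine ArithmeticFunction.vonMangoldt_le_log.trans (Real.log_le_log ?_ ?_)
        · exact_mod_cast (show 0 < n by omega)
        · exact_mod_cast hn.2
    _ = ((b : ℝ) - a) * Real.log b := by
        rw [Finset.sum_const, Nat.card_Ioc, nsmul_eq_mul, Nat.cast_sub hab]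

/-- The terms `n ≤ 2` of the twisted Chebyshev function: for `N ≥ 2`,
`∑_{n ≤ N} χ(n)Λ(n)n^{-it} = ∑_{2 < n ≤ N} χ(n)Λ(n)n^{-it} + χ(2)Λ(2)2^{-it}`, the last of norm
`≤ log 2`. [folklore] -/
theorem norm_sum_range_sub_sum_Ioc_le {q : ℕ} (χ : DirichletCharacter ℂ q) (t : ℝ) {N : ℕ} (hN : 2 ≤ N) :
    ‖∑ n ∈ Finset.range (N + 1), χ n * Λ n * (n : ℂ) ^ (-(t * I)) -
        ∑ n ∈ Finset.Ioc 2 N, χ n * Λ n * (n : ℂ) ^ (-(t * I))‖ ≤ Real.log 2 := by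
  have hsplit : ∑ n ∈ Finset.range (N + 1), χ n * Λ n * (n : ℂ) ^ (-(t * I)) =
      ∑ n ∈ Finset.range 3, χ n * Λ n * (n : ℂ) ^ (-(t * I)) +
        ∑ n ∈ Finset.Ioc 2 N, χ n * Λ n * (n : ℂ) ^ (-(t * I)) := by
    rw [Finset.range_eq_Ico, Finset.range_eq_Ico, ← Finset.sum_Ico_consecutive _ (by norm_num)
      (by omega : 3 ≤ N + 1)]
    congr 1
  rw [hsplit, add_sub_cancel_right, Finset.sum_range_succ, Finset.sum_range_succ, Finset.sum_range_one]
  simp only [Nat.cast_zero, ArithmeticFunction.map_zero, Complex.ofReal_zero, mul_zero, zero_mul,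
    zero_add, Nat.cast_one, ArithmeticFunction.vonMangoldt_apply_one]
  refine (norm_twistTerm_le χ t 2).trans ?_
  rw [ArithmeticFunction.vonMangoldt_apply_prime Nat.prime_two]
  push_cast
  exact le_rfl

end GRHTwistedPrimeSum

end Literature.NumberTheory.LFunctions
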